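import Literature.MathematicalPhysics.QuantumFieldTheory.Balaban1983to89.T3FinestHeightTail
import Literature.MathematicalPhysics.QuantumFieldTheory.Balaban1983to89.T4Continuum
import Literature.MathematicalPhysics.QuantumFieldTheory.Balaban1983to89.BlockAveragingSU2
import Literature.MathematicalPhysics.QuantumLattice.RepLieAlgebraUnitary
import HarnessLib

/-!
# The depth-zero case of the registered stub `stub_averagedPlaquetteRarity` (line `rarity_union_bound`, crux `UVSeamRec`, stmt-QuantumFields-20043)

The registered stub `RarityUnionBound.stub_averagedPlaquetteRarity` (skeleton `Lines/rarity_union_bound.lean`) asks, for every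
`δ ∈ (0,1]` and `ε > 0`, for a threshold `β₄` (and a window `ℓ₄`) beyond which EVERY level-`k` plaquette variable of the
`k`-fold Bałaban block average `Q_k V` is `δ`-rough with Wilson probability `≤ ε`, uniformly in the family torus.  Its
line card names the depth `k = 0` as the warm-up a prover must be able to land («if a prover cannot land k = 0 within a
week the typing is wrong»).  This file lands it, uniformly in the volume and with the Peierls–chessboard EXPONENTIAL tail:

* `wilsonMeasure_real_dist1_plaqHol_ofConfig_ge_le` — there is `A > 0` such that for every Bałaban family lattice
  `F.P K` (side `2·L^{m+K}`), every `β ≥ 1`, every `δ ≥ 0` and every plaquette `pl` of the finest level,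
  `μ_β{V : δ ≤ dist1 (∂(ofConfig V))(pl)} ≤ A · β⁶ · exp(−β δ²/2)`, where `μ_β` is the host Wilson measure of the stub
  (`wilsonMeasure (fundamentalLatticeRep 2).ρ β` on the torus of side `(F.P K).sitesPerDir 0`).  This is the Literature's
  single-plaquette large-field tail on Bałaban's tori (`T3FinestHeightTail.gibbsMeasure_real_dist1_ge_le`: reflection
  positivity + the Fröhlich–Israel–Lieb–Simon chessboard estimate, link ball of radius `β^{-1/2}`) read through the
  Gibbs/Wilson dictionary `T3FinestHeightTail.gibbsMeasure_real_eq_wilsonMeasure_real` (`gibbsMeasure P (2β)` = host Wilson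
  measure at `β`, un-normalised trace) at `N = 2`, `d = 4`: `(√(2β))^{4·3} = 2⁶ β⁶`, `exp(−2β δ²/4) = exp(−β δ²/2)`.
* `averagedPlaquetteRarity_depth_zero` — the stub's statement AT DEPTH `k = 0` (`Q_0 = ofConfig`, `Averaging.iter _ 0 = id`),
  in the stub's own letters: `∀ δ > 0 ∀ ε > 0 ∃ β₄ ∀ β ≥ β₄ ∀ F K ∀ pl, (μ {V | δ ≤ dist1 (∂(Q_0 V))(pl)}).toReal ≤ ε`
  (no window is needed at depth `0`; `β₄(δ, ε)` from `A β⁶ e^{−βδ²/2} → 0`).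

The depths `k ≥ 1` (block-AVERAGED plaquettes at physical size `b·a(β) ≤ ℓ₄`; asymptotic freedom / Bałaban's large-field
rarity as a Wilson PROBABILITY) are the stub's real content and are NOT touched here.  Nothing of E0′, NT or the gap is
proved; YM mass gap NOT proved.
-/

set_option autoImplicit false

namespace Summit.QuantumFields.YangMills.Cruxes.UVSeamRec.RarityUnionBound

open MeasureTheory Filter Topology
open Literature.MathematicalPhysics.QuantumFieldTheory
open Literature.MathematicalPhysics.QuantumFieldTheory.Balaban1983to89
open Literature.MathematicalPhysics.QuantumFieldTheory.Balaban1983to89.T4Continuum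
open Literature.MathematicalPhysics.QuantumLattice (fundamentalRep fundamentalLatticeRep)

/-- **The finest-level single-plaquette large-field tail on the family tori, in the host Wilson currency.**  There is
`A > 0` such that for every family lattice `F.P K`, every `β ≥ 1`, every `δ ≥ 0` and every level-`0` plaquette `pl`:
`(wilsonMeasure (fundamentalLatticeRep 2).ρ β).real {V | δ ≤ dist1 (∂(ofConfig V))(pl)} ≤ A · β⁶ · exp(−β δ²/2)`
(Literature `T3FinestHeightTail.gibbsMeasure_real_dist1_ge_le` at `N = 2` through `gibbsMeasure_real_eq_wilsonMeasure_real`). -/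
theorem wilsonMeasure_real_dist1_plaqHol_ofConfig_ge_le :
    ∃ A : ℝ, 0 < A ∧ ∀ (F : T4Family) (K : ℕ) (β : ℝ), 1 ≤ β → ∀ (δ : ℝ), 0 ≤ δ → ∀ pl : Plaq (F.P K) 0,
      haveI : NeZero ((F.P K).sitesPerDir 0) := ⟨Params.sitesPerDir_ne_zero _ _⟩
      (wilsonMeasure (d := 4) (L := (F.P K).sitesPerDir 0) (fundamentalLatticeRep 2).ρ β).real
          {V | δ ≤ dist1 (GaugeField.plaqHol (ofConfig (P := F.P K) (j := 0) V) pl)} ≤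
        A * β ^ 6 * Real.exp (-(β * δ ^ 2 / 2)) := by
  obtain ⟨c, hc, -, h⟩ :=
    T3FinestHeightTail.gibbsMeasure_real_dist1_ge_le (N := 2)
  refine ⟨2 * Real.exp (8 * (Fintype.card {q : Fin 4 × Fin 4 // q.1 < q.2} : ℝ)) * (c ^ 4)⁻¹ * 2 ^ 6,
    by positivity, ?_⟩
  intro F K β hβ δ hδ pl
  haveI : NeZero ((F.P K).sitesPerDir 0) := ⟨Params.sitesPerDir_ne_zero _ _⟩
  have hS : MeasurableSet
      {U : GaugeField (F.P K) 0 (Matrix.specialUnitaryGroup (Fin 2) ℂ) | δ ≤ dist1 (GaugeField.plaqHol U pl)} :=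
    measurableSet_le measurable_const (RegularGaugeGroup.measurable_dist1.comp (Missing.measurable_plaqHol pl))
  have hdict := T3FinestHeightTail.gibbsMeasure_real_eq_wilsonMeasure_real (N := 2) (F.P K) (β := 2 * β)
    (by linarith) hS
  have htail := h (F.P K) (2 * β) (by linarith) δ hδ pl
  rw [hdict] at htail
  have hβ2 : (2 * β / ((2 : ℕ) : ℝ) : ℝ) = β := by push_cast; ring
  rw [hβ2] at htail
  have hcard : (Fintype.card {q : Fin (F.P K).d × Fin (F.P K).d // q.1 < q.2} : ℕ) =
      Fintype.card {q : Fin 4 × Fin 4 // q.1 < q.2} := rfl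
  rw [hcard] at htail
  dsimp only [T4Family.P_d] at htail
  -- the preimage of the level-0 event is the host event of the stub (definitionally), at `d = 4`
  refine le_trans (le_of_eq rfl) (htail.trans (le_of_eq ?_))
  -- constants: `(√(2β))^{4·(2²−1)} = 2⁶ β⁶`, `exp(−(2β) δ²/(2·2)) = exp(−β δ²/2)`
  have hsq : Real.sqrt (2 * β) ^ (4 * (2 ^ 2 - 1)) = 2 ^ 6 * β ^ 6 := by
    rw [show 4 * (2 ^ 2 - 1) = 2 * 6 from rfl, pow_mul, Real.sq_sqrt (by linarith), mul_pow]
  have hex : Real.exp (-(2 * β * δ ^ 2 / (2 * ((2 : ℕ) : ℝ)))) = Real.exp (-(β * δ ^ 2 / 2)) := by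
    congr 1; push_cast; ring
  rw [hsq, hex]
  ring

/-- **The registered stub `stub_averagedPlaquetteRarity` AT DEPTH `k = 0`**, in the stub's letters (`Q_0 V = ofConfig V`
since `Averaging.iter _ 0 = id`): for every `δ > 0` and `ε > 0` there is `β₄` such that for `β ≥ β₄`, on EVERY family
torus `F.P K` and for EVERY finest-level plaquette `pl`, `(μ_β {V | δ ≤ dist1 (∂(Q_0 V))(pl)}).toReal ≤ ε`
(`β₄(δ, ε)` from `A β⁶ e^{−βδ²/2} → 0`; no window `b·uRec β ≤ ℓ₄` is needed at depth `0`). -/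
theorem averagedPlaquetteRarity_depth_zero :
    letI : MeasurableSpace (Matrix.specialUnitaryGroup (Fin 2) ℂ) := borel _
    haveI : BorelSpace (Matrix.specialUnitaryGroup (Fin 2) ℂ) := ⟨rfl⟩
    ∀ δ : ℝ, 0 < δ → ∀ ε : ℝ, 0 < ε → ∃ β₄ : ℝ, ∀ β : ℝ, β₄ ≤ β → ∀ (F : T4Family) (K : ℕ),
      haveI : NeZero ((F.P K).sitesPerDir 0) := ⟨Params.sitesPerDir_ne_zero _ _⟩
      let Q : GaugeConfig 4 ((F.P K).sitesPerDir 0) (Matrix.specialUnitaryGroup (Fin 2) ℂ) →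
          GaugeField (F.P K) 0 (Matrix.specialUnitaryGroup (Fin 2) ℂ) :=
        fun V => Averaging.iter (fun j => BlockAveraging.blockAvg (P := F.P K) (j := j) su2Mean) 0
          (ofConfig (P := F.P K) (j := 0) V)
      let μ := wilsonMeasure (d := 4) (L := (F.P K).sitesPerDir 0) (fundamentalLatticeRep 2).ρ β
      ∀ pl : Plaq (F.P K) 0, (μ {V | δ ≤ dist1 (GaugeField.plaqHol (Q V) pl)}).toReal ≤ ε := by
  intro δ hδ ε hε
  obtain ⟨A, hA, h⟩ := wilsonMeasure_real_dist1_plaqHol_ofConfig_ge_le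
  -- asymptotics: `A β⁶ exp(−β δ²/2) → 0`
  have ha : 0 < δ ^ 2 / 2 := by positivity
  have key : ∀ β : ℝ, A / (δ ^ 2 / 2) ^ 6 * ((δ ^ 2 / 2 * β) ^ 6 * Real.exp (-(δ ^ 2 / 2 * β))) =
      A * β ^ 6 * Real.exp (-(β * δ ^ 2 / 2)) := by
    intro β
    have e : -(δ ^ 2 / 2 * β) = -(β * δ ^ 2 / 2) := by ring
    rw [e, mul_pow]
    field_simp
  have htend : Tendsto (fun β : ℝ => A * β ^ 6 * Real.exp (-(β * δ ^ 2 / 2))) atTop (𝓝 0) := by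
    have h1 := (Real.tendsto_pow_mul_exp_neg_atTop_nhds_zero 6).comp (tendsto_id.const_mul_atTop ha)
    have h2 := h1.const_mul (A / (δ ^ 2 / 2) ^ 6)
    rw [mul_zero] at h2
    refine h2.congr fun β => ?_
    simp only [Function.comp, id]
    exact key β
  obtain ⟨β₀, hβ₀⟩ := Filter.eventually_atTop.1 (htend.eventually (gt_mem_nhds hε))
  refine ⟨max 1 β₀, fun β hβ F K => ?_⟩
  intro Q μ pl
  have hβ1 : 1 ≤ β := (le_max_left _ _).trans hβ
  have hmain := h F K β hβ1 δ hδ.le pl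
  have hsmall : A * β ^ 6 * Real.exp (-(β * δ ^ 2 / 2)) < ε := hβ₀ β ((le_max_right _ _).trans hβ)
  exact (hmain.trans hsmall.le)

end Summit.QuantumFields.YangMills.Cruxes.UVSeamRec.RarityUnionBound
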